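import Summits.QuantumAdvantage.QuantumAdvantage.Theses.HankelLift
import Literature.NumberTheory.LFunctions.MoebiusExpSumMinorArc

/-!
# Birth skeleton for the crux `HankelLift.HankelDiscrepancy` (stmt-QuantumAdvantage-18439)

Crux (route `route-QuantumAdvantage-HankelLift`, rank 2):
`∀ C, ∀ᶠ n, ∀ S T ⊆ [0,2^n), |∑_{x∈S} ∑_{y∈T} λ(x+y+2)| ≤ 4^n / n^C`
— the rectangle discrepancy of the Liouville HANKEL pattern `(x,y) ↦ λ(x+y+2)`.

## The line (Davenport ∘ Parseval; two registered stubs, composition proved)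

* `stub_majorArc` — MAJOR ARCS for `λ`: for all `A B`, for all large `N`, if `θ` is within
  `(log N)^B / N` of a reduced fraction `a/q` with `q ≤ (log N)^B`, then
  `‖∑_{n ≤ N} λ(n) e(nθ)‖ ≤ N/(log N)^A`.  Siegel–Walfisz for `λ` in progressions (tree, PROVED:
  `SiegelWalfiszMoebius.liouville_progression` + `SiegelWalfiszMoebius_holds`), grouping by residues
  mod `q` (template: `MoebiusDyadicModuli.afExpSum_div_eq_sum_residues`) and partial summation against
  `e(nβ)` (template: `MoebiusDyadicModuli.norm_afExpSum_moebius_near_twoPow_le`, the `q = 2^t` case).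
  Size L (bookkeeping-heavy, no new idea).  [Davenport1937; IwaniecKowalski2004 §13.5;
  MontgomeryVaughan2007 §11.3]
* `stub_rectangleFourier` — RECTANGLE ⟸ SYMBOL (Parseval / Cauchy–Schwarz on `ℤ/(2N+s)` or on
  `ℝ/ℤ`): for any `f : ℕ → ℝ`, shift `s ≥ 1` and `S, T ⊆ [0,N)`,
  `|∑_{x∈S,y∈T} f(x+y+s)| ≤ (sup_θ ‖∑_{m ≤ 2N+s} f(m) e(mθ)‖) · √(|S| |T|)`, because
  `∑_{S×T} f(x+y+s) = ∫₀¹ F(θ) e(sθ)· conj Ŝ(θ)· conj T̂(θ) dθ` and `∫|Ŝ||T̂| ≤ ‖Ŝ‖₂‖T̂‖₂ = √(|S||T|)`.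
  Size M.  (Lindsey-lemma shape; the Babai–Nisan–Szegedy / Chung–Tetali "character of a sum" move.)
  [doi:10.1016/0022-0000(92)90047-M; AroraBarak2009 pp. 332–333; Jukna2012; arXiv:2508.13384 Thm 7.1]
* PROVED here: `davenport_of_majorArc` (Davenport's uniform bound `‖∑_{n≤N} λ(n)e(nθ)‖ ≤ N/(log N)^A`
  for all large `N`, from the major-arc statement and the tree's minor-arc theorem
  `MoebiusExpSum.liouville_minorArc` = Green 2012 Prop. 4 for `λ`), the dyadic bookkeeping
  `davenport_dyadic_le`, the composition `hankelDiscrepancy_of_stubs : <stub₁ sig> → <stub₂ sig> → <crux,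
  unfolded>` (axioms `propext, Classical.choice, Quot.sound` only), and the skeleton theorem
  `HankelDiscrepancy_of : HankelDiscrepancy := hankelDiscrepancy_of_stubs stub_majorArc stub_rectangleFourier`.

Hardest stub: `stub_majorArc` (L).  Disproof.lean: none exists for this crux (nothing to honour).
Dead lines: none recorded.  The crux is a theorem in print (Davenport 1937 + Parseval); this line is
its standard proof, cut at the two genuinely separate pieces of work the tree lacks.
-/

noncomputable section

namespace Summit.QuantumAdvantage.QuantumAdvantage.Cruxes.HankelDiscrepancy.Birth

open Finset Real ArithmeticFunction Filter
open scoped FourierTransform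
open Literature.NumberTheory.Sieve.Vinogradov (afExpSum norm_afExpSum_le)
open Literature.NumberTheory.LFunctions
open Summit.QuantumAdvantage.QuantumAdvantage.Theses.HankelLift (HankelDiscrepancy)

/-! ### Registered stubs -/

/-- **Major arcs for the Liouville exponential sum** (stub, size L): for all `A B : ℕ`, for all
large `N`, every `θ` with `|θ - a/q| ≤ (log N)^B/N` for some reduced `a/q`, `1 ≤ q ≤ (log N)^B`, has
`‖∑_{n ≤ N} λ(n) e(nθ)‖ ≤ N/(log N)^A`.  Route to a proof: group `n` by residues mod `q`
(`e(na/q)` is `q`-periodic), bound each progression sum by the tree's PROVED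
`SiegelWalfiszMoebius.liouville_progression SiegelWalfiszMoebius_holds` (saving `(log x)^{-(A+2B+2)}`,
uniform for `q ≤ (log x)^B`), and remove the twist `e(nβ)`, `|β| ≤ (log N)^B/N`, by partial
summation over prefixes (as in `MoebiusDyadicModuli.norm_afExpSum_moebius_near_twoPow_le`).
[cite: Davenport1937] [cite: IwaniecKowalski2004, §13.5] -/
theorem stub_majorArc :
    ∀ A B : ℕ, ∀ᶠ N : ℕ in atTop, ∀ θ : ℝ, ∀ q : ℕ, 1 ≤ q → (q : ℝ) ≤ Real.log N ^ B →
      ∀ a : ℤ, IsCoprime a q → |θ - a / q| ≤ Real.log N ^ B / N →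
      ‖afExpSum (⇑(liouville : ArithmeticFunction ℝ)) N θ‖ ≤ N / Real.log N ^ A := by
  sorry

/-- **Rectangle sums of a Hankel pattern are bounded by the sup of its symbol** (stub, size M):
for `f : ℕ → ℝ`, a shift `s ≥ 1`, and `S, T ⊆ [0, N)`,
`|∑_{x ∈ S} ∑_{y ∈ T} f(x+y+s)| ≤ B · √(|S|·|T|)` whenever `‖∑_{1 ≤ m ≤ 2N+s} f(m) e(mθ)‖ ≤ B` for
all `θ`.  Proof sketch: `∑_{S×T} f(x+y+s) = ∫₀¹ F(θ) 𝐞(-sθ) conj(Ŝ θ) conj(T̂ θ) dθ` with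
`F = afExpSum f (2N+s)`, `Ŝ(θ) = ∑_{x∈S} e(xθ)`; then Cauchy–Schwarz and Parseval
`∫|Ŝ|² = |S|` (equivalently: discrete Fourier transform on `ℤ/(2N+s)ℤ`, no wrap-around since
`x+y+s < 2N+s`).  [cite: AroraBarak2009, Lemma 13.14 (Lindsey) pp. 332–333]
[cite: BabaiNisanSzegedy1992, doi:10.1016/0022-0000(92)90047-M] -/
theorem stub_rectangleFourier :
    ∀ (N s : ℕ), 1 ≤ s → ∀ (f : ℕ → ℝ) (B : ℝ),
      (∀ θ : ℝ, ‖afExpSum f (2 * N + s) θ‖ ≤ B) →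
      ∀ S T : Finset (Fin N),
        |∑ x ∈ S, ∑ y ∈ T, f (x.val + y.val + s)| ≤ B * Real.sqrt ((S.card : ℝ) * (T.card : ℝ)) := by
  sorry

/-! ### Proved glue: Davenport's uniform bound from minor + major arcs -/

/-- **Davenport's theorem for `λ`** from the major-arc stub and the tree's minor-arc theorem
(`MoebiusExpSum.liouville_minorArc`, Green 2012 Prop. 4): for every `A`, for all large `N`,
`sup_θ ‖∑_{n ≤ N} λ(n) e(nθ)‖ ≤ N/(log N)^A`.  If the sum exceeded `N/(log N)^A`, Proposition 4 with
`δ = (log N)^{-A}` would place `θ` within `(C₀ (log N)^{A+4})^{50}/N ≤ (log N)^{50(A+5)}/N` of a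
reduced `a/q` with `q ≤ (log N)^{50(A+5)}` (once `log N ≥ C₀`), where the major-arc bound applies.
[cite: Davenport1937] -/
theorem davenport_of_majorArc
    (hmaj : ∀ A B : ℕ, ∀ᶠ N : ℕ in atTop, ∀ θ : ℝ, ∀ q : ℕ, 1 ≤ q → (q : ℝ) ≤ Real.log N ^ B →
      ∀ a : ℤ, IsCoprime a q → |θ - a / q| ≤ Real.log N ^ B / N →
      ‖afExpSum (⇑(liouville : ArithmeticFunction ℝ)) N θ‖ ≤ N / Real.log N ^ A) :
    ∀ A : ℕ, ∀ᶠ N : ℕ in atTop, ∀ θ : ℝ,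
      ‖afExpSum (⇑(liouville : ArithmeticFunction ℝ)) N θ‖ ≤ N / Real.log N ^ A := by
  intro A
  obtain ⟨C₀, hC₀, hmin⟩ := MoebiusExpSum.liouville_minorArc
  have hlog : ∀ᶠ N : ℕ in atTop, C₀ ≤ Real.log N :=
    (Real.tendsto_log_atTop.comp tendsto_natCast_atTop_atTop).eventually_ge_atTop C₀
  filter_upwards [hmaj A (50 * (A + 5)), hlog, eventually_ge_atTop 3] with N hN hlogN h3 θ
  by_contra hlt
  rw [not_le] at hlt
  have hL1 : 1 ≤ Real.log N := hC₀.trans hlogN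
  have hL0 : 0 < Real.log N := one_pos.trans_le hL1
  have hN0 : (0 : ℝ) < N := by exact_mod_cast (by omega : 0 < N)
  have hδ0 : 0 < (Real.log N ^ A)⁻¹ := inv_pos.mpr (pow_pos hL0 A)
  have hδ1 : (Real.log N ^ A)⁻¹ ≤ 1 := inv_le_one_of_one_le₀ (one_le_pow₀ hL1)
  have hbig : (Real.log N ^ A)⁻¹ * N ≤ ‖afExpSum (⇑(liouville : ArithmeticFunction ℝ)) N θ‖ := by
    rw [inv_mul_eq_div]; exact hlt.le
  obtain ⟨q, hq1, hqle, a, hcop, hθ⟩ := hmin N h3 θ _ hδ0 hδ1 hbig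
  have hP : (C₀ * Real.log N ^ 4 / (Real.log N ^ A)⁻¹) ^ 50 ≤ Real.log N ^ (50 * (A + 5)) := by
    rw [pow_mul', div_inv_eq_mul]
    refine pow_le_pow_left₀ (by positivity) ?_ 50
    have h4 : 0 ≤ Real.log N ^ 4 * Real.log N ^ A :=
      mul_nonneg (pow_nonneg hL0.le _) (pow_nonneg hL0.le _)
    calc C₀ * Real.log N ^ 4 * Real.log N ^ A = C₀ * (Real.log N ^ 4 * Real.log N ^ A) := by ring
      _ ≤ Real.log N * (Real.log N ^ 4 * Real.log N ^ A) := mul_le_mul_of_nonneg_right hlogN h4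
      _ = Real.log N ^ (A + 5) := by ring
  have h := hN θ q hq1 (hqle.trans hP) a hcop (hθ.trans (div_le_div_of_nonneg_right hP hN0.le))
  exact absurd h (not_le.mpr hlt)

/-! ### Proved glue: dyadic bookkeeping -/

/-- `n/2 ≤ log (2·2^n + 2)`. [folklore] -/
theorem half_le_log_dyadic (n : ℕ) : (n : ℝ) / 2 ≤ Real.log ((2 * 2 ^ n + 2 : ℕ) : ℝ) := by
  have h2 : (n : ℝ) * Real.log 2 ≤ Real.log ((2 * 2 ^ n + 2 : ℕ) : ℝ) := by
    rw [← Real.log_pow]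
    refine Real.log_le_log (by positivity) ?_
    push_cast
    nlinarith [show (0 : ℝ) ≤ 2 ^ n by positivity]
  have hn : (0 : ℝ) ≤ n := Nat.cast_nonneg n
  nlinarith [Real.log_two_gt_d9, h2, hn]

/-- The real-number inequality behind the dyadic conversion: if `n ≥ 2^(C+3)` and `L ≥ n/2` then
`(2·2^n + 2)/L^(C+1) ≤ 2^n/n^C`. [folklore] -/
theorem dyadic_ineq (C n : ℕ) (hn : 2 ^ (C + 3) ≤ n) (L : ℝ) (hL : (n : ℝ) / 2 ≤ L) :
    ((2 * 2 ^ n + 2 : ℕ) : ℝ) / L ^ (C + 1) ≤ 2 ^ n / (n : ℝ) ^ C := by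
  have hn8 : (2 : ℝ) ^ (C + 3) ≤ n := by exact_mod_cast hn
  have hn0 : (0 : ℝ) < n := lt_of_lt_of_le (by positivity) hn8
  have hL0 : 0 < L := by linarith
  have hpow : ((n : ℝ) / 2) ^ (C + 1) ≤ L ^ (C + 1) := pow_le_pow_left₀ (by positivity) hL _
  rw [div_le_div_iff₀ (by positivity) (by positivity)]
  push_cast
  calc (2 * 2 ^ n + 2 : ℝ) * (n : ℝ) ^ C ≤ (4 * 2 ^ n) * (n : ℝ) ^ C := by
        gcongr
        linarith [one_le_pow₀ (show (1 : ℝ) ≤ 2 by norm_num) (n := n)]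
    _ = 2 ^ n * (2 ^ (C + 3) * (n : ℝ) ^ C / 2 ^ (C + 1)) := by
        field_simp
        ring
    _ ≤ 2 ^ n * ((n : ℝ) * (n : ℝ) ^ C / 2 ^ (C + 1)) := by gcongr
    _ = 2 ^ n * ((n : ℝ) / 2) ^ (C + 1) := by rw [div_pow]; ring
    _ ≤ 2 ^ n * L ^ (C + 1) := by gcongr

/-- Dyadic form of Davenport's bound, in the normalisation the rectangle lemma consumes: for every
`C`, for all large `n`, `sup_θ ‖∑_{m ≤ 2·2^n+2} λ(m) e(mθ)‖ ≤ 2^n / n^C`. [folklore] -/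
theorem davenport_dyadic_le
    (hD : ∀ A : ℕ, ∀ᶠ N : ℕ in atTop, ∀ θ : ℝ,
      ‖afExpSum (⇑(liouville : ArithmeticFunction ℝ)) N θ‖ ≤ N / Real.log N ^ A) (C : ℕ) :
    ∀ᶠ n : ℕ in atTop, ∀ θ : ℝ,
      ‖afExpSum (⇑(liouville : ArithmeticFunction ℝ)) (2 * 2 ^ n + 2) θ‖ ≤ 2 ^ n / (n : ℝ) ^ C := by
  have hT : Tendsto (fun n : ℕ => 2 * 2 ^ n + 2) atTop atTop :=
    tendsto_atTop_atTop.2 fun b => ⟨b, fun n hn => by have := @Nat.lt_two_pow_self n; omega⟩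
  filter_upwards [hT.eventually (hD (C + 1)), eventually_ge_atTop (2 ^ (C + 3))] with n hDn hn θ
  exact (hDn θ).trans (dyadic_ineq C n hn _ (half_le_log_dyadic n))

/-! ### The composition -/

/-- **Composition** (sorry-free real proof): major arcs (statement of `stub_majorArc`, verbatim) +
rectangle-from-symbol (statement of `stub_rectangleFourier`, verbatim) ⇒ the crux statement, through
Davenport's uniform bound (minor arcs from the tree) at length `2·2^n + 2` and `√(|S||T|) ≤ 2^n`.
The conclusion is deliberately the UNFOLDED crux (head `∀`), so that `HankelDiscrepancy_of` below is the
only theorem whose head is the crux decl (`#h21_check_skeleton` shape). [folklore] -/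
theorem hankelDiscrepancy_of_stubs :
    (∀ A B : ℕ, ∀ᶠ N : ℕ in atTop, ∀ θ : ℝ, ∀ q : ℕ, 1 ≤ q → (q : ℝ) ≤ Real.log N ^ B →
      ∀ a : ℤ, IsCoprime a q → |θ - a / q| ≤ Real.log N ^ B / N →
      ‖afExpSum (⇑(liouville : ArithmeticFunction ℝ)) N θ‖ ≤ N / Real.log N ^ A) →
    (∀ (N s : ℕ), 1 ≤ s → ∀ (f : ℕ → ℝ) (B : ℝ),
      (∀ θ : ℝ, ‖afExpSum f (2 * N + s) θ‖ ≤ B) →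
      ∀ S T : Finset (Fin N),
        |∑ x ∈ S, ∑ y ∈ T, f (x.val + y.val + s)| ≤ B * Real.sqrt ((S.card : ℝ) * (T.card : ℝ))) →
    ∀ C : ℕ, ∀ᶠ n : ℕ in Filter.atTop, ∀ S T : Finset (Fin (2 ^ n)),
      |∑ x ∈ S, ∑ y ∈ T, ((ArithmeticFunction.liouville (x.val + y.val + 2) : ℤ) : ℝ)| ≤
        (4 : ℝ) ^ n / (n : ℝ) ^ C := by
  intro hmaj hrect C
  filter_upwards [davenport_dyadic_le (davenport_of_majorArc hmaj) C] with n hDn S T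
  have hrect' := hrect (2 ^ n) 2 (by norm_num) (⇑(liouville : ArithmeticFunction ℝ)) _
    (fun θ => by simpa [two_mul, pow_succ, mul_comm] using hDn θ) S T
  have hB0 : (0 : ℝ) ≤ 2 ^ n / (n : ℝ) ^ C := by positivity
  have hS : (S.card : ℝ) ≤ 2 ^ n := by exact_mod_cast card_finset_fin_le S
  have hT : (T.card : ℝ) ≤ 2 ^ n := by exact_mod_cast card_finset_fin_le T
  have hsqrt : Real.sqrt ((S.card : ℝ) * (T.card : ℝ)) ≤ 2 ^ n :=
    calc Real.sqrt ((S.card : ℝ) * (T.card : ℝ)) ≤ Real.sqrt (2 ^ n * 2 ^ n) :=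
          Real.sqrt_le_sqrt (mul_le_mul hS hT (Nat.cast_nonneg _) (by positivity))
      _ = 2 ^ n := Real.sqrt_mul_self (by positivity)
  simp only [intCoe_apply] at hrect'
  refine hrect'.trans ?_
  calc 2 ^ n / (n : ℝ) ^ C * Real.sqrt ((S.card : ℝ) * (T.card : ℝ)) ≤ 2 ^ n / (n : ℝ) ^ C * 2 ^ n :=
        mul_le_mul_of_nonneg_left hsqrt hB0
    _ = (4 : ℝ) ^ n / (n : ℝ) ^ C := by
        rw [show (4 : ℝ) = 2 * 2 by norm_num, mul_pow]; ring

/-- **THE skeleton theorem** — the crux `HankelLift.HankelDiscrepancy` BY NAME from the two declared stubs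
via the sorry-free composition `hankelDiscrepancy_of_stubs` (`ledger skeleton check` shape: no hypotheses;
`sorry` enters only through `stub_majorArc` and `stub_rectangleFourier`; when both stubs are proved this
file is the crux proof). [folklore] -/
theorem HankelDiscrepancy_of : HankelDiscrepancy :=
  hankelDiscrepancy_of_stubs stub_majorArc stub_rectangleFourier

end Summit.QuantumAdvantage.QuantumAdvantage.Cruxes.HankelDiscrepancy.Birth
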